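import Summits.CriticalPhenomena.PercolationContinuityZ3.Theorems.PercNearOneGluingNoHeavyLowerTailSwitchRelaxFinc19ChecksE
import HarnessLib

/-!
# Finite-relaxation replay of the clean switching certificate `Finc19`: kernel checks at input types (pieces `checkAtY_6_6` … `checkAtY_6_13`)

Support file (prover prim-masterthm-p1 gen 2; `--supports stmt-CriticalPhenomena-4575`).  No named facts, no sorries.  Split from
`…SwitchRelaxFinc19` only to keep each file's kernel time small.
-/

namespace Summit.CriticalPhenomena.PercolationContinuityZ3.Theorems

namespace SwitchRelax

namespace Finc19

/-- Kernel evaluation of the finite relaxation at input type `6`, `Y`-type `6`. [this work] -/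
theorem checkAtY_6_6 : certFinc19.checkAtY 6 6 = true := by decide +kernel

/-- Kernel evaluation of the finite relaxation at input type `6`, `Y`-type `7`. [this work] -/
theorem checkAtY_6_7 : certFinc19.checkAtY 6 7 = true := by decide +kernel

/-- Kernel evaluation of the finite relaxation at input type `6`, `Y`-type `8`. [this work] -/
theorem checkAtY_6_8 : certFinc19.checkAtY 6 8 = true := by decide +kernel

/-- Kernel evaluation of the finite relaxation at input type `6`, `Y`-type `9`. [this work] -/
theorem checkAtY_6_9 : certFinc19.checkAtY 6 9 = true := by decide +kernel

/-- Kernel evaluation of the finite relaxation at input type `6`, `Y`-type `10`. [this work] -/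
theorem checkAtY_6_10 : certFinc19.checkAtY 6 10 = true := by decide +kernel

/-- Kernel evaluation of the finite relaxation at input type `6`, `Y`-type `11`. [this work] -/
theorem checkAtY_6_11 : certFinc19.checkAtY 6 11 = true := by decide +kernel

/-- Kernel evaluation of the finite relaxation at input type `6`, `Y`-type `12`. [this work] -/
theorem checkAtY_6_12 : certFinc19.checkAtY 6 12 = true := by decide +kernel

/-- Kernel evaluation of the finite relaxation at input type `6`, `Y`-type `13`. [this work] -/
theorem checkAtY_6_13 : certFinc19.checkAtY 6 13 = true := by decide +kernel

end Finc19

end SwitchRelax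

end Summit.CriticalPhenomena.PercolationContinuityZ3.Theorems
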